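/-
Copyright: lit-balaban cell, Phase-2 proof seat p24 (gen 24).  Released under Apache 2.0 license as described in the
file LICENSE.
-/
import Literature.MathematicalPhysics.QuantumFieldTheory.Balaban1983to89.B4Eq246SquareSummable
import Literature.MathematicalPhysics.QuantumFieldTheory.Balaban1983to89.B4Ineq227LatticeL2

/-!
# `Balaban1983to89.B4Ineq228FreePropagator` — [Balaban1983RegularityDecay] (2.28) p. 580 for the FREE PROPAGATOR `G_j` of
# p. 584 on `ξℤ^{d+1}`: `0 < G_j ≤ c₀I`, `‖G_jf‖₂ ≤ c₀‖f‖₂`, `c₀⁻¹ = min{8,a} + m²`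

statement-level skeleton of published theorems with citation tags; proofs where landed; nothing here is a claim about
the Yang–Mills mass gap

CITATION HEADER.  T. Bałaban, *Regularity and decay of lattice Green's functions*, Commun. Math. Phys. **89** (1983)
571–597, doi:10.1007/bf01214744 [Balaban1983RegularityDecay] (cell paper B4; held text
`paper:balaban1983-cmp89-regularity-decay`, journal page = PDF page + 570), p. 580 [PDF 10] (2.28), p. 584 [PDF 14]
(2.44)–(2.46); renders `pub-balaban/b2b-balaban-ref1/pages/1983-cmp89-regularity-decay/…-p010-x2.png`, `…-p014-x2.png` (unit
`lit-balaban-p24` gen 24; HOME `run/shared/lean/pub/lit-balaban/`; SKELETON rows **B4.Eq2.27** ((2.26)–(2.28)) and **B4.Eq2.43**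
((2.43)–(2.48)) — cells only, both proved-headed).

WHAT IS PRINTED (p. 580).  «… and from this [(2.27)] and (2.26) we get 0 < G_k(□,0) ≤ c₀I, c₀⁻¹ = min{π², a_k}, hence
‖G_k(□,0)f‖₂ ≤ c₀‖f‖₂. (2.28)» — for finite unions `□` of unit cubes; the tree has this AS PRINTED for such `□`
(`B4Ineq228OperatorOrder.green_pos` ∕ `green_form_upper` ∕ `green_norm_bound`).  This file is the same conclusion for the
propagator «G_j with free boundary conditions on ξZ^d» of p. 584, i.e. `□` replaced by the whole fine lattice, where `G_j` is
the operator `G246` of `B4Eq246SolvesEq244` ∕ `B4Eq246SquareSummable` (the inverse transform of (2.46), THE `ℓ²` solution of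
(2.44)) and the lower bound (2.27) is `B4Ineq227LatticeL2.energy_lower_bound_l2`.

WHAT THIS MODULE PROVES (kernel-checked; theorems only; 0 `sorry`; axioms standard).  `n ≥ 1`, `a ≥ 0`, `m² > 0` (so that
`G246 f` is defined through (2.46) and square-summable), `f ∈ ℓ¹(ξℤ^{d+1})`, `γ₀ := min{8,a} + m²`:
* `G246_form_lower` — `γ₀‖G_jf‖²_{ℓ²} ≤ Re⟨G_jf, f⟩`;
* **`G246_nonneg` ∕ `G246_pos`** — «`0 < G_j`»: `Re⟨f, G_jf⟩ ≥ γ₀‖G_jf‖² ≥ 0`, and `> 0` unless `f = 0`;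
* **`G246_l2_bound`** — «`G_j ≤ c₀I`, `‖G_jf‖₂ ≤ c₀‖f‖₂`» with `c₀⁻¹ = γ₀`: `γ₀‖G_jf‖_{ℓ²} ≤ ‖f‖_{ℓ²}`.

DICTIONARY / HONEST SCOPE.  (i) `A = 0`, scalar fields, `Ω = ξℤ^{d+1}`; `c₀⁻¹ = min{π²,a_k} ↦ min{8,a} + m²` (repaired
constant, census G-B4-03; the mass only helps).  (ii) `f ∈ ℓ¹` (the class on which `G246` is built); the extension of `G_j` to
all of `ℓ²` by density is not carried out.  (iii) Value = kernel certificate of (2.28) for the free infinite-lattice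
propagator of the (2.43)–(2.48) chain; cells only; NOT summit progress.
-/

namespace Literature.MathematicalPhysics.QuantumFieldTheory.Balaban1983to89.B4Ineq228FreePropagator

open Complex Finset
open Literature.MathematicalPhysics.QuantumFieldTheory.Balaban1983to89.B4Green244
open Literature.MathematicalPhysics.QuantumFieldTheory.Balaban1983to89.B4Eq246SolvesEq244
open Literature.MathematicalPhysics.QuantumFieldTheory.Balaban1983to89.B4Eq246SquareSummable
open Literature.MathematicalPhysics.QuantumFieldTheory.Balaban1983to89.B4Ineq227LatticeL2
open scoped Real ComplexConjugate

noncomputable section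

variable {d : ℕ}

/-- `ℓ¹ ⊂ ℓ²` on the lattice. [folklore] -/
private theorem summable_normSq_of_summable_norm {f : (Fin (d + 1) → ℤ) → ℂ} (hf : Summable fun z => ‖f z‖) :
    Summable fun z => ‖f z‖ ^ 2 :=
  Literature.Analysis.FunctionSpaces.Torus.summable_norm_sq_of_summable_norm hf

/-- **`γ₀‖G_jf‖² ≤ Re⟨G_jf, f⟩`**: the lower bound (1.8)/(2.27) on `ξℤ^{d+1}` applied to `φ = G_jf`, with `D(G_jf) = f`
(`B4Eq246SolvesEq244.opD_G246`). [cite: Balaban1983RegularityDecay, (2.27)–(2.28) p.580, (2.44)–(2.46) p.584; dictionary (Ω = ξℤ^{d+1}, A = 0)] -/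
theorem G246_form_lower (n : ℕ) [NeZero n] {a m2 : ℝ} (ha : 0 ≤ a) (hm : 0 < m2) {f : (Fin (d + 1) → ℤ) → ℂ}
    (hf : Summable fun z => ‖f z‖) :
    (min 8 a + m2) * ∑' z, ‖G246 n a m2 f z‖ ^ 2 ≤ (∑' z, conj (G246 n a m2 f z) * f z).re := by
  have h := energy_lower_bound_l2 n ha hm.le (summable_normSq_G246 n ha hm hf)
  simp_rw [opD_G246 n ha hm hf] at h
  exact h

/-- **«0 < G_j» (NON-NEGATIVITY)**: `Re⟨f, G_jf⟩ ≥ (min{8,a} + m²)‖G_jf‖²_{ℓ²} ≥ 0` for every `f ∈ ℓ¹(ξℤ^{d+1})`.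
[cite: Balaban1983RegularityDecay, (2.28) p.580; dictionary (Ω = ξℤ^{d+1}, A = 0, G_k(□,0) ↦ G_j of p.584)] -/
theorem G246_nonneg (n : ℕ) [NeZero n] {a m2 : ℝ} (ha : 0 ≤ a) (hm : 0 < m2) {f : (Fin (d + 1) → ℤ) → ℂ}
    (hf : Summable fun z => ‖f z‖) : 0 ≤ (∑' z, conj (f z) * G246 n a m2 f z).re := by
  have h := G246_form_lower n ha hm hf
  have hconj : (∑' z, conj (f z) * G246 n a m2 f z) = conj (∑' z, conj (G246 n a m2 f z) * f z) := by
    rw [Complex.conj_tsum]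
    exact tsum_congr fun z => by rw [map_mul, Complex.conj_conj, mul_comm]
  rw [hconj, Complex.conj_re]
  have h0 : 0 ≤ (min 8 a + m2) * ∑' z, ‖G246 n a m2 f z‖ ^ 2 :=
    mul_nonneg (add_nonneg (le_min (by norm_num) ha) hm.le) (tsum_nonneg fun z => sq_nonneg _)
  linarith

/-- **«0 < G_j» (STRICT)**: `Re⟨f, G_jf⟩ > 0` for every non-zero `f ∈ ℓ¹(ξℤ^{d+1})` (`G_jf ≠ 0` since `D(G_jf) = f`).
[cite: Balaban1983RegularityDecay, (2.28) p.580; dictionary (Ω = ξℤ^{d+1}, A = 0, G_k(□,0) ↦ G_j of p.584)] -/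
theorem G246_pos (n : ℕ) [NeZero n] {a m2 : ℝ} (ha : 0 ≤ a) (hm : 0 < m2) {f : (Fin (d + 1) → ℤ) → ℂ}
    (hf : Summable fun z => ‖f z‖) (hf0 : f ≠ 0) : 0 < (∑' z, conj (f z) * G246 n a m2 f z).re := by
  have h := G246_form_lower n ha hm hf
  have hconj : (∑' z, conj (f z) * G246 n a m2 f z) = conj (∑' z, conj (G246 n a m2 f z) * f z) := by
    rw [Complex.conj_tsum]
    exact tsum_congr fun z => by rw [map_mul, Complex.conj_conj, mul_comm]
  rw [hconj, Complex.conj_re]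
  -- `G_jf ≠ 0`, hence `Σ|G_jf|² > 0`
  have hG2 := summable_normSq_G246 n ha hm hf
  have hne : ∃ z, G246 n a m2 f z ≠ 0 := by
    by_contra hall
    push Not at hall
    apply hf0
    funext z
    have := opD_G246 n ha hm hf z
    rw [← this]
    simp [opD, negLap, blockAvg, hall]
  obtain ⟨z₀, hz₀⟩ := hne
  have hpos : 0 < ∑' z, ‖G246 n a m2 f z‖ ^ 2 :=
    lt_of_lt_of_le (by positivity) (hG2.le_tsum z₀ fun z _ => sq_nonneg _)
  have hγ : 0 < min 8 a + m2 := add_pos_of_nonneg_of_pos (le_min (by norm_num) ha) hm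
  nlinarith [mul_pos hγ hpos]

/-- **(2.28) FOR THE FREE PROPAGATOR ON `ξℤ^{d+1}`: `‖G_jf‖_{ℓ²} ≤ c₀‖f‖_{ℓ²}`, `c₀⁻¹ = min{8,a} + m²`** — for every
`f ∈ ℓ¹(ξℤ^{d+1})` (`⊂ ℓ²`), `a ≥ 0`, `m² > 0`; from `‖Dφ‖ ≥ γ₀‖φ‖` (`B4Ineq227LatticeL2.norm_opD_ge`) at `φ = G_jf`, `D(G_jf) = f`.
[cite: Balaban1983RegularityDecay, (2.28) p.580; repaired constant; dictionary (Ω = ξℤ^{d+1}, A = 0, G_k(□,0) ↦ G_j of p.584)] -/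
theorem G246_l2_bound (n : ℕ) [NeZero n] {a m2 : ℝ} (ha : 0 ≤ a) (hm : 0 < m2) {f : (Fin (d + 1) → ℤ) → ℂ}
    (hf : Summable fun z => ‖f z‖) :
    (min 8 a + m2) * Real.sqrt (∑' z, ‖G246 n a m2 f z‖ ^ 2) ≤ Real.sqrt (∑' z, ‖f z‖ ^ 2) := by
  have h := norm_opD_ge n ha hm.le (summable_normSq_G246 n ha hm hf)
  simp_rw [opD_G246 n ha hm hf] at h
  exact h

/-- (2.28) in the printed shape `‖G_jf‖₂ ≤ c₀‖f‖₂` with `c₀ = (min{8,a} + m²)⁻¹`.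
[cite: Balaban1983RegularityDecay, (2.28) p.580; repaired constant; dictionary (Ω = ξℤ^{d+1}, A = 0)] -/
theorem G246_l2_bound' (n : ℕ) [NeZero n] {a m2 : ℝ} (ha : 0 ≤ a) (hm : 0 < m2) {f : (Fin (d + 1) → ℤ) → ℂ}
    (hf : Summable fun z => ‖f z‖) :
    Real.sqrt (∑' z, ‖G246 n a m2 f z‖ ^ 2) ≤ (min 8 a + m2)⁻¹ * Real.sqrt (∑' z, ‖f z‖ ^ 2) := by
  have hγ : 0 < min 8 a + m2 := add_pos_of_nonneg_of_pos (le_min (by norm_num) ha) hm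
  rw [le_inv_mul_iff₀ hγ]
  exact G246_l2_bound n ha hm hf

end

end Literature.MathematicalPhysics.QuantumFieldTheory.Balaban1983to89.B4Ineq228FreePropagator
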